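import Literature.RingTheory.MvPowerSeries.ConvergentClosedIdeals
import Mathlib.LinearAlgebra.Finsupp.LinearCombination
import HarnessLib

/-!
# The Denef–van den Dries finiteness lemma for convergent power series

Topic `Literature/RingTheory/MvPowerSeries`.  Let `G(u, w) = ∑_J G_J(u) w^J ∈ 𝕜{u, w}` be a
convergent power series in "horizontal" variables `u = (u_i)_{i ∈ ι}` and "vertical" variables
`w = (w_j)_{j ∈ κ}` (finitely many of each; `𝕜` an infinite complete normed field, e.g. `ℝ`).
**Then there are `d ∈ ℕ` and CONVERGENT units `U_J ∈ 𝕜{u, w}`, `|J| ≤ d`, with `U_J(u, 0) = 1`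
and**

  `G(u, w) = ∑_{|J| ≤ d} G_J(u) w^J U_J(u, w)`      (`finiteness_property`).

This is the key "finiteness property, a first step towards Weierstrass preparation" of
J. Denef, L. van den Dries, *p-adic and real subanalytic sets*, Ann. of Math. 128 (1988), §4
(Lemma 4.12 there; see J.-P. Rolin, *Establishing the o-minimality for expansions of the real
field*, in LMS Lecture Note Ser. 349 (2008), §3.2, for this formulation), on which their
quantifier elimination for the real field with restricted analytic functions rests.  The formal
statement (in `𝕜⟦u⟧⟦w⟧`) is immediate from Noetherianity; the point is the convergence of the
`U_J`, which we get from the Rückert basis theorem and Krull's closedness of ideals in `𝕜{u, w}`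
(`ConvergentNoetherian.lean`, `ConvergentClosedIdeals.lean`): the tail `G - ∑_{|J|≤d} G_J w^J`
lies in the closure of the ideal generated by the `G_J w^J`, `|J| ≤ d`, hence in the ideal, and a
`w`-degree surgery of the coefficients makes them `≡ 0 (mod w)`.

Everything is proved; no named facts.

## References

* J. Denef, L. van den Dries, *p-adic and real subanalytic sets*, Ann. of Math. 128 (1988),
  §4. [DenefvandenDries1988]
* H. Grauert, R. Remmert, *Analytische Stellenalgebren*, Springer (1971), Kap. I §5.
  [GrauertRemmert1971]
-/

noncomputable section

open MvPowerSeries Finsupp Filter Function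
open scoped NNReal ENNReal Topology BigOperators

namespace Literature.RingTheory.MvPowerSeries

universe u

variable {ι κ : Type u} {𝕜 : Type*} [NormedField 𝕜]

/-! ### 1. Horizontal and vertical parts of exponents; `w`-degree -/

section Parts

/-- The horizontal (`u`-) part of an exponent. [folklore] -/
def hpart (e : ι ⊕ κ →₀ ℕ) : ι →₀ ℕ := (sumFinsuppAddEquivProdFinsupp e).1

/-- The vertical (`w`-) part of an exponent. [folklore] -/
def vpart (e : ι ⊕ κ →₀ ℕ) : κ →₀ ℕ := (sumFinsuppAddEquivProdFinsupp e).2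

/-- Values of `hpart`. [folklore] -/
@[simp] theorem hpart_apply (e : ι ⊕ κ →₀ ℕ) (i : ι) : hpart e i = e (Sum.inl i) :=
  fst_sumFinsuppAddEquivProdFinsupp e i

/-- Values of `vpart`. [folklore] -/
@[simp] theorem vpart_apply (e : ι ⊕ κ →₀ ℕ) (j : κ) : vpart e j = e (Sum.inr j) :=
  snd_sumFinsuppAddEquivProdFinsupp e j

/-- `hpart` is additive. [folklore] -/
@[simp] theorem hpart_add (e e' : ι ⊕ κ →₀ ℕ) : hpart (e + e') = hpart e + hpart e' := by
  ext i; simp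

/-- `vpart` is additive. [folklore] -/
@[simp] theorem vpart_add (e e' : ι ⊕ κ →₀ ℕ) : vpart (e + e') = vpart e + vpart e' := by
  ext j; simp

/-- `hpart` of `sumElim`. [folklore] -/
@[simp] theorem hpart_sumElim (β : ι →₀ ℕ) (J : κ →₀ ℕ) : hpart (sumElim β J) = β := by
  ext i; simp

/-- `vpart` of `sumElim`. [folklore] -/
@[simp] theorem vpart_sumElim (β : ι →₀ ℕ) (J : κ →₀ ℕ) : vpart (sumElim β J) = J := by
  ext j; simp

/-- An exponent is the `sumElim` of its parts. [folklore] -/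
theorem sumElim_hpart_vpart (e : ι ⊕ κ →₀ ℕ) : sumElim (hpart e) (vpart e) = e := by
  ext (i | j) <;> simp [sumElim_apply]

/-- Exponents are determined by their parts. [folklore] -/
theorem eq_iff_parts (e e' : ι ⊕ κ →₀ ℕ) : e = e' ↔ hpart e = hpart e' ∧ vpart e = vpart e' := by
  constructor
  · rintro rfl; exact ⟨rfl, rfl⟩
  · rintro ⟨h1, h2⟩
    rw [← sumElim_hpart_vpart e, ← sumElim_hpart_vpart e', h1, h2]

/-- The **`w`-degree** of an exponent: the total degree of its vertical part. [folklore] -/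
def wdeg (e : ι ⊕ κ →₀ ℕ) : ℕ := (vpart e).degree

/-- `wdeg` is additive. [folklore] -/
@[simp] theorem wdeg_add (e e' : ι ⊕ κ →₀ ℕ) : wdeg (e + e') = wdeg e + wdeg e' := by
  simp [wdeg]

/-- The `w`-degree is at most the total degree. [folklore] -/
theorem wdeg_le_degree [Finite ι] [Finite κ] (e : ι ⊕ κ →₀ ℕ) : wdeg e ≤ e.degree := by
  classical
  haveI := Fintype.ofFinite ι; haveI := Fintype.ofFinite κ
  rw [wdeg, Finsupp.degree_eq_sum, Finsupp.degree_eq_sum, Fintype.sum_sum_type]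
  simp only [vpart_apply]
  exact Nat.le_add_left _ _

/-- `wdeg e = 0` iff `vpart e = 0`. [folklore] -/
theorem wdeg_eq_zero_iff (e : ι ⊕ κ →₀ ℕ) : wdeg e = 0 ↔ vpart e = 0 :=
  Finsupp.degree_eq_zero_iff _

/-- Weights split along `ι ⊕ κ`. [folklore] -/
theorem wt_sumElim (ρ : ι ⊕ κ → ℝ≥0) (β : ι →₀ ℕ) (J : κ →₀ ℕ) :
    wt ρ (sumElim β J) = wt (ρ ∘ Sum.inl) β * wt (ρ ∘ Sum.inr) J := by
  have hsplit : sumElim β J = mapDomain Sum.inl β + mapDomain Sum.inr J := by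
    ext (i | j)
    · rw [Finsupp.add_apply, sumElim_apply, Sum.elim_inl, mapDomain_apply Sum.inl_injective,
        mapDomain_notin_range _ _ (by rintro ⟨j, hj⟩; exact Sum.inr_ne_inl hj), add_zero]
    · rw [Finsupp.add_apply, sumElim_apply, Sum.elim_inr, mapDomain_apply Sum.inr_injective,
        mapDomain_notin_range _ _ (by rintro ⟨i, hi⟩; exact Sum.inl_ne_inr hi), zero_add]
  rw [hsplit, wt_add, wt_mapDomain Sum.inl_injective, wt_mapDomain Sum.inr_injective]

end Parts

/-! ### 2. Vertical slices and the terms `G_J(u) w^J` -/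

section Slices

/-- The `w^J`-slice `G_J(u)` of `G(u, w) = ∑_J G_J(u) w^J`. [cite: DenefvandenDries1988, §4] -/
def sliceW (J : κ →₀ ℕ) (G : MvPowerSeries (ι ⊕ κ) 𝕜) : MvPowerSeries ι 𝕜 :=
  fun β => coeff (sumElim β J) G

/-- Coefficients of `sliceW`. [folklore] -/
@[simp] theorem coeff_sliceW (J : κ →₀ ℕ) (G : MvPowerSeries (ι ⊕ κ) 𝕜) (β : ι →₀ ℕ) :
    coeff β (sliceW J G) = coeff (sumElim β J) G := rfl

/-- **Slices are dominated**: `‖G_J‖_{ρ∘inl} (ρ∘inr)^J ≤ ‖G‖_ρ`. [folklore] -/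
theorem wnorm_sliceW_mul_le (ρ : ι ⊕ κ → ℝ≥0) (J : κ →₀ ℕ) (G : MvPowerSeries (ι ⊕ κ) 𝕜) :
    wnorm (ρ ∘ Sum.inl) (sliceW J G) * wt (ρ ∘ Sum.inr) J ≤ wnorm ρ G := by
  unfold wnorm
  rw [← ENNReal.tsum_mul_right]
  calc ∑' β, ((‖coeff β (sliceW J G)‖₊ * wt (ρ ∘ Sum.inl) β : ℝ≥0) : ℝ≥0∞) * wt (ρ ∘ Sum.inr) J
      = ∑' β : ι →₀ ℕ, ((‖coeff (sumElim β J) G‖₊ * wt ρ (sumElim β J) : ℝ≥0) : ℝ≥0∞) := by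
        refine tsum_congr fun β => ?_
        rw [coeff_sliceW, wt_sumElim, ← ENNReal.coe_mul]
        push_cast; ring
    _ ≤ ∑' e, ((‖coeff e G‖₊ * wt ρ e : ℝ≥0) : ℝ≥0∞) :=
        ENNReal.tsum_comp_le_tsum_of_injective (fun β β' h => by
          simpa using congrArg hpart h) _

/-- Slices of convergent series are convergent. [folklore] -/
theorem HasPosRadius.sliceW (J : κ →₀ ℕ) {G : MvPowerSeries (ι ⊕ κ) 𝕜} (hG : HasPosRadius G) :
    HasPosRadius (sliceW J G) := by
  obtain ⟨ρ, hρ, hfin⟩ := hG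
  refine ⟨ρ ∘ Sum.inl, fun i => hρ _, ?_⟩
  have hb : (wt (ρ ∘ Sum.inr) J : ℝ≥0∞) ≠ 0 := ENNReal.coe_ne_zero.mpr (wt_pos (fun j => hρ _) J).ne'
  refine lt_of_le_of_lt ?_ (ENNReal.div_lt_top hfin.ne hb)
  rw [ENNReal.le_div_iff_mul_le (Or.inl hb) (Or.inl ENNReal.coe_ne_top)]
  exact wnorm_sliceW_mul_le ρ J G

open scoped Classical in
/-- Coefficients of `rename inl F`: `[u^β w^0] = [u^β] F`, all others vanish. [folklore] -/
theorem coeff_rename_inl (F : MvPowerSeries ι 𝕜) (e : ι ⊕ κ →₀ ℕ) :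
    coeff e (rename (Function.Embedding.inl : ι ↪ ι ⊕ κ) F) =
      if vpart e = 0 then coeff (hpart e) F else 0 := by
  by_cases he : vpart e = 0
  · rw [if_pos he]
    have : e = Finsupp.embDomain (Function.Embedding.inl : ι ↪ ι ⊕ κ) (hpart e) := by
      rw [Finsupp.embDomain_eq_mapDomain]
      ext (i | j)
      · change e (Sum.inl i) = Finsupp.mapDomain Sum.inl (hpart e) (Sum.inl i)
        rw [Finsupp.mapDomain_apply Sum.inl_injective, hpart_apply]
      · rw [Finsupp.mapDomain_notin_range]
        · have := DFunLike.congr_fun he j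
          simpa using this
        · rintro ⟨i, hi⟩; exact Sum.inl_ne_inr hi
    conv_lhs => rw [this]
    rw [coeff_embDomain_rename]
  · rw [if_neg he]
    apply coeff_rename_eq_zero
    rintro ⟨y, hy⟩
    apply he
    ext j
    have := DFunLike.congr_fun hy (Sum.inr j)
    rw [Finsupp.mapDomain_notin_range _ _ (by rintro ⟨i, hi⟩; exact Sum.inl_ne_inr hi)] at this
    simpa using this.symm

/-- **The term `G_J(u) w^J`** of the vertical expansion of `G`. [cite: DenefvandenDries1988, §4] -/
def wTerm (J : κ →₀ ℕ) (G : MvPowerSeries (ι ⊕ κ) 𝕜) : MvPowerSeries (ι ⊕ κ) 𝕜 :=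
  rename (Function.Embedding.inl : ι ↪ ι ⊕ κ) (sliceW J G) * monomial (sumElim 0 J) 1

open scoped Classical in
/-- **Coefficients of `G_J(u) w^J`**: those of `G` with vertical part `J`, and no others.
[folklore] -/
theorem coeff_wTerm (J : κ →₀ ℕ) (G : MvPowerSeries (ι ⊕ κ) 𝕜) (e : ι ⊕ κ →₀ ℕ) :
    coeff e (wTerm J G) = if vpart e = J then coeff e G else 0 := by
  rw [wTerm, coeff_mul_monomial, mul_one]
  by_cases hJ : (sumElim 0 J : ι ⊕ κ →₀ ℕ) ≤ e
  · rw [if_pos hJ, coeff_rename_inl]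
    have hv : vpart (e - sumElim 0 J) = vpart e - J := by
      ext j; simp
    have hh : hpart (e - sumElim 0 J) = hpart e := by
      ext i; simp
    have hJ' : J ≤ vpart e := fun j => by
      have := hJ (Sum.inr j); simpa [sumElim_apply] using this
    rw [hv, hh, coeff_sliceW]
    by_cases he : vpart e = J
    · rw [if_pos (by rw [he, tsub_self]), if_pos he, ← he, sumElim_hpart_vpart]
    · rw [if_neg, if_neg he]
      intro h
      exact he (le_antisymm (tsub_eq_zero_iff_le.mp h) hJ')
  · rw [if_neg hJ, if_neg]
    intro he
    apply hJ
    rintro (i | j)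
    · simp [sumElim_apply]
    · have := DFunLike.congr_fun he j
      simp only [vpart_apply] at this
      simp [sumElim_apply, this]

open scoped Classical in
/-- Coefficients of a sum of terms over a finite set of vertical exponents. [folklore] -/
theorem coeff_sum_wTerm (S : Finset (κ →₀ ℕ)) (G : MvPowerSeries (ι ⊕ κ) 𝕜) (e : ι ⊕ κ →₀ ℕ) :
    coeff e (∑ J ∈ S, wTerm J G) = if vpart e ∈ S then coeff e G else 0 := by
  rw [map_sum]
  simp_rw [coeff_wTerm]
  rw [Finset.sum_ite_eq]

/-- The terms of a convergent series are convergent. [folklore] -/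
theorem HasPosRadius.wTerm (J : κ →₀ ℕ) {G : MvPowerSeries (ι ⊕ κ) 𝕜} (hG : HasPosRadius G) :
    HasPosRadius (wTerm J G) :=
  ((hG.sliceW J).rename_embedding _).mul (HasPosRadius.monomial _ _)

end Slices

/-! ### 3. `w`-degree bounds -/

section WDeg

/-- All monomials of `F` have `w`-degree `≥ p`. [folklore] -/
def WDegGE (p : ℕ) (F : MvPowerSeries (ι ⊕ κ) 𝕜) : Prop :=
  ∀ e : ι ⊕ κ →₀ ℕ, wdeg e < p → coeff e F = 0

/-- All monomials of `F` have `w`-degree `≤ p`. [folklore] -/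
def WDegLE (p : ℕ) (F : MvPowerSeries (ι ⊕ κ) 𝕜) : Prop :=
  ∀ e : ι ⊕ κ →₀ ℕ, p < wdeg e → coeff e F = 0

/-- `w`-degree lower bounds add under multiplication. [folklore] -/
theorem WDegGE.mul {p q : ℕ} {F H : MvPowerSeries (ι ⊕ κ) 𝕜} (hF : WDegGE p F) (hH : WDegGE q H) :
    WDegGE (p + q) (F * H) := by
  classical
  intro e he
  rw [coeff_mul]
  refine Finset.sum_eq_zero fun x hx => ?_
  have hx' : x.1 + x.2 = e := Finset.mem_antidiagonal.mp hx
  have hsum : wdeg x.1 + wdeg x.2 = wdeg e := by rw [← hx', wdeg_add]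
  by_cases h1 : wdeg x.1 < p
  · rw [hF _ h1, zero_mul]
  · rw [hH _ (by omega), mul_zero]

/-- `w`-degree upper bounds add under multiplication. [folklore] -/
theorem WDegLE.mul {p q : ℕ} {F H : MvPowerSeries (ι ⊕ κ) 𝕜} (hF : WDegLE p F) (hH : WDegLE q H) :
    WDegLE (p + q) (F * H) := by
  classical
  intro e he
  rw [coeff_mul]
  refine Finset.sum_eq_zero fun x hx => ?_
  have hx' : x.1 + x.2 = e := Finset.mem_antidiagonal.mp hx
  have hsum : wdeg x.1 + wdeg x.2 = wdeg e := by rw [← hx', wdeg_add]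
  by_cases h1 : p < wdeg x.1
  · rw [hF _ h1, zero_mul]
  · rw [hH _ (by omega), mul_zero]

/-- Bounds of sums. [folklore] -/
theorem WDegGE.sum {α : Type*} {p : ℕ} (s : Finset α) {F : α → MvPowerSeries (ι ⊕ κ) 𝕜}
    (h : ∀ a ∈ s, WDegGE p (F a)) : WDegGE p (∑ a ∈ s, F a) := fun e he => by
  rw [map_sum]; exact Finset.sum_eq_zero fun a ha => h a ha e he

/-- Bounds of sums. [folklore] -/
theorem WDegLE.sum {α : Type*} {p : ℕ} (s : Finset α) {F : α → MvPowerSeries (ι ⊕ κ) 𝕜}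
    (h : ∀ a ∈ s, WDegLE p (F a)) : WDegLE p (∑ a ∈ s, F a) := fun e he => by
  rw [map_sum]; exact Finset.sum_eq_zero fun a ha => h a ha e he

/-- Lower bounds are antitone in the bound. [folklore] -/
theorem WDegGE.mono {p q : ℕ} (hpq : q ≤ p) {F : MvPowerSeries (ι ⊕ κ) 𝕜} (h : WDegGE p F) :
    WDegGE q F := fun e he => h e (lt_of_lt_of_le he hpq)

/-- Upper bounds are monotone in the bound. [folklore] -/
theorem WDegLE.mono {p q : ℕ} (hpq : p ≤ q) {F : MvPowerSeries (ι ⊕ κ) 𝕜} (h : WDegLE p F) :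
    WDegLE q F := fun e he => h e (lt_of_le_of_lt hpq he)

/-- A series with both `WDegLE d` and `WDegGE (d+1)` vanishes. [folklore] -/
theorem eq_zero_of_wDegLE_of_wDegGE {d : ℕ} {F : MvPowerSeries (ι ⊕ κ) 𝕜} (h1 : WDegLE d F)
    (h2 : WDegGE (d + 1) F) : F = 0 := by
  ext e
  rw [coeff_zero]
  by_cases he : wdeg e ≤ d
  · exact h2 e (Nat.lt_succ_of_le he)
  · exact h1 e (not_le.mp he)

/-- The term `G_J w^J` is `w`-homogeneous of degree `|J|`. [folklore] -/
theorem wDegGE_wTerm (J : κ →₀ ℕ) (G : MvPowerSeries (ι ⊕ κ) 𝕜) : WDegGE J.degree (wTerm J G) := by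
  intro e he
  rw [coeff_wTerm, if_neg]
  rintro rfl
  exact lt_irrefl _ he

/-- The term `G_J w^J` is `w`-homogeneous of degree `|J|`. [folklore] -/
theorem wDegLE_wTerm (J : κ →₀ ℕ) (G : MvPowerSeries (ι ⊕ κ) 𝕜) : WDegLE J.degree (wTerm J G) := by
  intro e he
  rw [coeff_wTerm, if_neg]
  rintro rfl
  exact lt_irrefl _ he

/-- **Truncation in `w`-degree**: the part of `F` of `w`-degree `≤ p`. [folklore] -/
def wTrunc (p : ℕ) (F : MvPowerSeries (ι ⊕ κ) 𝕜) : MvPowerSeries (ι ⊕ κ) 𝕜 :=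
  fun e => if wdeg e ≤ p then coeff e F else 0

/-- Coefficients of `wTrunc`. [folklore] -/
@[simp] theorem coeff_wTrunc (p : ℕ) (F : MvPowerSeries (ι ⊕ κ) 𝕜) (e : ι ⊕ κ →₀ ℕ) :
    coeff e (wTrunc p F) = if wdeg e ≤ p then coeff e F else 0 := rfl

/-- The truncation has `w`-degree `≤ p`. [folklore] -/
theorem wDegLE_wTrunc (p : ℕ) (F : MvPowerSeries (ι ⊕ κ) 𝕜) : WDegLE p (wTrunc p F) := fun e he => by
  rw [coeff_wTrunc, if_neg (not_le.mpr he)]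

/-- The rest has `w`-degree `≥ p + 1`. [folklore] -/
theorem wDegGE_sub_wTrunc (p : ℕ) (F : MvPowerSeries (ι ⊕ κ) 𝕜) : WDegGE (p + 1) (F - wTrunc p F) :=
  fun e he => by rw [map_sub, coeff_wTrunc, if_pos (Nat.le_of_lt_succ he), sub_self]

/-- `‖wTrunc p F‖_ρ ≤ ‖F‖_ρ`. [folklore] -/
theorem wnorm_wTrunc_le (ρ : ι ⊕ κ → ℝ≥0) (p : ℕ) (F : MvPowerSeries (ι ⊕ κ) 𝕜) :
    wnorm ρ (wTrunc p F) ≤ wnorm ρ F := by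
  refine ENNReal.tsum_le_tsum fun e => ENNReal.coe_le_coe.mpr ?_
  rw [coeff_wTrunc]; split_ifs
  · exact le_rfl
  · simp

/-- Truncations of convergent series are convergent. [folklore] -/
theorem HasPosRadius.wTrunc (p : ℕ) {F : MvPowerSeries (ι ⊕ κ) 𝕜} (hF : HasPosRadius F) :
    HasPosRadius (wTrunc p F) := by
  obtain ⟨ρ, hρ, hfin⟩ := hF
  exact ⟨ρ, hρ, (wnorm_wTrunc_le ρ p F).trans_lt hfin⟩

/-- **Vanishing at `w = 0`**: all coefficients with zero vertical part vanish.
[cite: DenefvandenDries1988, §4] -/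
def VanishesAtW (F : MvPowerSeries (ι ⊕ κ) 𝕜) : Prop :=
  ∀ e : ι ⊕ κ →₀ ℕ, vpart e = 0 → coeff e F = 0

/-- Positive `w`-degree implies vanishing at `w = 0`. [folklore] -/
theorem WDegGE.vanishesAtW {p : ℕ} (hp : 1 ≤ p) {F : MvPowerSeries (ι ⊕ κ) 𝕜} (h : WDegGE p F) :
    VanishesAtW F := fun e he => h e (by rw [(wdeg_eq_zero_iff e).mpr he]; exact hp)

end WDeg

/-! ### 4. The finiteness property -/

section DegLE

variable [Finite κ]

/-- The finite set of vertical exponents of degree `≤ d`. [folklore] -/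
def degLE (d : ℕ) : Finset (κ →₀ ℕ) := (Finsupp.finite_of_degree_le (σ := κ) d).toFinset

/-- Membership in `degLE`. [folklore] -/
@[simp] theorem mem_degLE {d : ℕ} {J : κ →₀ ℕ} : J ∈ degLE d ↔ J.degree ≤ d := by
  simp [degLE]

/-- `degLE` is monotone. [folklore] -/
theorem degLE_mono {d d' : ℕ} (h : d ≤ d') : (degLE d : Finset (κ →₀ ℕ)) ⊆ degLE d' :=
  fun _ hJ => mem_degLE.mpr ((mem_degLE.mp hJ).trans h)

/-- Coefficients of the `w`-degree tail `G - ∑_{|J| ≤ m} G_J w^J`: those of `G` of `w`-degree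
`> m`. [folklore] -/
theorem coeff_sub_sum_wTerm (m : ℕ) (G : MvPowerSeries (ι ⊕ κ) 𝕜) (e : ι ⊕ κ →₀ ℕ) :
    coeff e (G - ∑ J ∈ degLE m, wTerm J G) = if wdeg e ≤ m then 0 else coeff e G := by
  classical
  rw [map_sub, coeff_sum_wTerm]
  by_cases h : wdeg e ≤ m
  · rw [if_pos (mem_degLE.mpr h), if_pos h, sub_self]
  · rw [if_neg (fun h' => h (mem_degLE.mp h')), if_neg h, sub_zero]

end DegLE

section Finiteness

variable [Finite ι] [Finite κ] [CompleteSpace 𝕜] [Infinite 𝕜]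

/-- **The Denef–van den Dries finiteness property** (convergent form).  For a convergent
`G(u, w) = ∑_J G_J(u) w^J` in finitely many horizontal variables `u` and vertical variables `w`
there are `d` and convergent `U_J`, `|J| ≤ d`, with `U_J - 1` vanishing at `w = 0`, such that
`G = ∑_{|J| ≤ d} G_J(u) w^J U_J(u, w)`. [cite: DenefvandenDries1988, §4] -/
theorem finiteness_property {G : MvPowerSeries (ι ⊕ κ) 𝕜} (hG : HasPosRadius G) :
    ∃ (d : ℕ) (U : (κ →₀ ℕ) → MvPowerSeries (ι ⊕ κ) 𝕜),
      (∀ J, HasPosRadius (U J)) ∧ (∀ J, VanishesAtW (U J - 1)) ∧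
      G = ∑ J ∈ degLE d, wTerm J G * U J := by
  classical
  -- work in the Noetherian local ring `R = 𝕜{u, w}`
  haveI : IsNoetherianRing (convergent (ι ⊕ κ) 𝕜) := convergent.isNoetherianRing (𝕜 := 𝕜) (ι ⊕ κ)
  set GR : convergent (ι ⊕ κ) 𝕜 := ⟨G, hG⟩ with hGR
  set aR : (κ →₀ ℕ) → convergent (ι ⊕ κ) 𝕜 := fun J => ⟨wTerm J G, hG.wTerm J⟩ with haR
  -- the increasing chain of ideals generated by the `a_J`, `|J| ≤ d`
  set 𝔍 : ℕ → Ideal (convergent (ι ⊕ κ) 𝕜) :=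
    fun d => Ideal.span (Set.range fun J : degLE (κ := κ) d => aR J) with h𝔍
  have h𝔍mono : Monotone 𝔍 := by
    intro d d' hdd'
    refine Ideal.span_mono ?_
    rintro _ ⟨⟨J, hJ⟩, rfl⟩
    exact ⟨⟨J, degLE_mono hdd' hJ⟩, rfl⟩
  obtain ⟨d, hd⟩ := (monotone_stabilizes_iff_noetherian.mpr
    (inferInstance : IsNoetherian (convergent (ι ⊕ κ) 𝕜) (convergent (ι ⊕ κ) 𝕜))) ⟨𝔍, h𝔍mono⟩
  have haR_mem : ∀ L : κ →₀ ℕ, aR L ∈ 𝔍 d := by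
    intro L
    have h1 : aR L ∈ 𝔍 (max d L.degree) :=
      Ideal.subset_span ⟨⟨L, mem_degLE.mpr (le_max_right _ _)⟩, rfl⟩
    have h2 : 𝔍 d = 𝔍 (max d L.degree) := hd _ (le_max_left _ _)
    rw [h2]; exact h1
  -- the tails `G_m = G - ∑_{|J| ≤ m} a_J`
  set Gm : ℕ → convergent (ι ⊕ κ) 𝕜 := fun m => GR - ∑ J ∈ degLE m, aR J with hGm
  have hGm_coe : ∀ m, ((Gm m : convergent (ι ⊕ κ) 𝕜) : MvPowerSeries (ι ⊕ κ) 𝕜) =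
      G - ∑ J ∈ degLE m, wTerm J G := by
    intro m; simp only [hGm, hGR, haR]; push_cast; rfl
  -- `G_{m}` has order `≥ m + 1`, hence lies in `𝔪^{m+1}`
  have hGm_pow : ∀ m, Gm m ∈ (IsLocalRing.maximalIdeal (convergent (ι ⊕ κ) 𝕜)) ^ (m + 1) := by
    intro m
    refine mem_maximalIdeal_pow_of_coeff_eq_zero _ _ fun α hα => ?_
    rw [hGm_coe, coeff_sub_sum_wTerm, if_pos]
    exact (wdeg_le_degree α).trans (Nat.le_of_lt_succ hα)
  -- Krull: `G_d ∈ 𝔍_d`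
  have hGd : Gm d ∈ 𝔍 d := by
    refine Ideal.mem_of_forall_sub_mem_pow _ _ fun n => ?_
    refine ⟨Gm d - Gm (max d n), ?_, ?_⟩
    · -- `G_d - G_{max d n} = ∑_{d < |J| ≤ max d n} a_J ∈ 𝔍_d`
      have : Gm d - Gm (max d n) = ∑ J ∈ degLE (max d n) \ degLE d, aR J := by
        simp only [hGm]
        rw [← Finset.sum_sdiff (degLE_mono (le_max_left d n))]
        ring
      rw [this]
      exact Ideal.sum_mem _ fun J _ => haR_mem J
    · rw [sub_sub_cancel]
      exact Ideal.pow_le_pow_right (by omega) (hGm_pow (max d n))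
  -- write `G_d = ∑_J c_J a_J`
  obtain ⟨c, hc⟩ := Submodule.mem_span_range_iff_exists_fun (R := convergent (ι ⊕ κ) 𝕜) |>.mp hGd
  change ∑ i, c i * aR i = Gm d at hc
  -- the `w`-degree surgery: low and high parts of the coefficients
  set clo : degLE (κ := κ) d → MvPowerSeries (ι ⊕ κ) 𝕜 :=
    fun J => wTrunc (d - (J : κ →₀ ℕ).degree) (c J : MvPowerSeries (ι ⊕ κ) 𝕜) with hclo
  set chi : degLE (κ := κ) d → MvPowerSeries (ι ⊕ κ) 𝕜 :=
    fun J => (c J : MvPowerSeries (ι ⊕ κ) 𝕜) - clo J with hchi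
  have hsplit : (G - ∑ J ∈ degLE d, wTerm J G) =
      (∑ J : degLE (κ := κ) d, clo J * wTerm J G) + ∑ J : degLE (κ := κ) d, chi J * wTerm J G := by
    rw [← Finset.sum_add_distrib, ← hGm_coe d]
    have := congrArg (fun x : convergent (ι ⊕ κ) 𝕜 => (x : MvPowerSeries (ι ⊕ κ) 𝕜)) hc
    rw [← this]
    push_cast
    refine Finset.sum_congr rfl fun J _ => ?_
    simp only [hchi, haR]
    ring
  -- the low part vanishes by `w`-degree comparison
  have hlo : (∑ J : degLE (κ := κ) d, clo J * wTerm J G) = 0 := by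
    apply eq_zero_of_wDegLE_of_wDegGE (d := d)
    · refine WDegLE.sum _ fun J _ => ?_
      have h1 := (wDegLE_wTrunc (d - (J : κ →₀ ℕ).degree) (c J : MvPowerSeries (ι ⊕ κ) 𝕜)).mul
        (wDegLE_wTerm (J : κ →₀ ℕ) G)
      have hJ : (J : κ →₀ ℕ).degree ≤ d := mem_degLE.mp J.2
      exact h1.mono (by omega)
    · have hhi : WDegGE (d + 1) (∑ J : degLE (κ := κ) d, chi J * wTerm J G) := by
        refine WDegGE.sum _ fun J _ => ?_
        have h1 := (wDegGE_sub_wTrunc (d - (J : κ →₀ ℕ).degree) (c J : MvPowerSeries (ι ⊕ κ) 𝕜)).mul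
          (wDegGE_wTerm (J : κ →₀ ℕ) G)
        have hJ : (J : κ →₀ ℕ).degree ≤ d := mem_degLE.mp J.2
        exact h1.mono (by omega)
      have htail : WDegGE (d + 1) (G - ∑ J ∈ degLE d, wTerm J G) := fun e he => by
        rw [coeff_sub_sum_wTerm, if_pos (Nat.le_of_lt_succ he)]
      have heq : (∑ J : degLE (κ := κ) d, clo J * wTerm J G) =
          (G - ∑ J ∈ degLE d, wTerm J G) - ∑ J : degLE (κ := κ) d, chi J * wTerm J G := by
        rw [hsplit]; ring
      rw [heq]
      intro e he
      rw [map_sub, htail e he, hhi e he, sub_zero]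
  -- the units
  set U : (κ →₀ ℕ) → MvPowerSeries (ι ⊕ κ) 𝕜 :=
    fun J => if h : J ∈ degLE d then 1 + chi ⟨J, h⟩ else 1 with hU
  refine ⟨d, U, fun J => ?_, fun J => ?_, ?_⟩
  · simp only [hU]
    split_ifs with h
    · exact HasPosRadius.one.add ((c _).2.sub ((c _).2.wTrunc _))
    · exact HasPosRadius.one
  · simp only [hU]
    split_ifs with h
    · rw [add_sub_cancel_left]
      have hJ : J.degree ≤ d := mem_degLE.mp h
      exact (wDegGE_sub_wTrunc _ _).vanishesAtW (by omega)
    · rw [sub_self]; exact fun e _ => rfl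
  · -- `G = ∑ a_J + (G - ∑ a_J) = ∑ a_J (1 + chi_J)`
    have h1 : G = ∑ J : degLE (κ := κ) d, wTerm (J : κ →₀ ℕ) G +
        ∑ J : degLE (κ := κ) d, chi J * wTerm J G := by
      have h2 := hsplit
      rw [hlo, zero_add] at h2
      rw [Finset.sum_coe_sort (degLE d) (fun J => wTerm J G), ← h2]
      ring
    calc G = ∑ J : degLE (κ := κ) d, (wTerm (J : κ →₀ ℕ) G + chi J * wTerm J G) := by
          rw [Finset.sum_add_distrib]; exact h1
      _ = ∑ J : degLE (κ := κ) d, wTerm (J : κ →₀ ℕ) G * U J :=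
          Finset.sum_congr rfl fun J _ => by simp only [hU, dif_pos J.2]; ring
      _ = ∑ J ∈ degLE d, wTerm J G * U J := Finset.sum_coe_sort (degLE d) (fun J => wTerm J G * U J)

end Finiteness

end Literature.RingTheory.MvPowerSeries
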